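import Summits.QuantumFields.YangMills.Theorems.UnitScaleTiltProp7TorusExpWeightSum
import Literature.MathematicalPhysics.QuantumFieldTheory.Balaban1983to89.T3ContinuumYM3Torus
import HarnessLib

/-!
# THE ROW SUM OF THE ONE-STEP ORGAN'S WEIGHT `e^{−κ·tdist(b, b′)}` OVER BONDS IS SIDE-UNIFORM (the M-lemma of O1 v18's ROW-SUM MAJORANT currency), DEFINITION-FREE

Cell `ym3-torus` (YM ladder rung R3 = continuum `SU(2)` Yang–Mills on the three-torus — a RUNG, NOT d = 4, NOT infinite volume, NOT a mass gap, NOT Clay).  Width seat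
`ym-ust-20520-w4` (gen 21); `--supports stmt-QuantumFields-20520 --as helper`, count-neutral, definition-free, default heartbeats; no registry, binder or `Lines/` edit
(registry `Lines/semiclassical_s2beta.lean` v11.4 untouched, ★★OWNER RULING №36); no claim on the crux.

WHAT THIS IS.  The O1 v18 re-typing (ideator g26 `CURRENCY-MEMO-g26.md`, LEAD w3 g23 WORD №5, ★★OWNER g39 RULING №58: ROW-SUM MAJORANT `∃ k, (∀ b, Σ_{b′} k b b′·e^{κ·tdist} ≤ w) ∧
|ΔΔR| ≤ k b b′`, in which kernels with exponentially summable rows compose) needs ONE geometric fact uniformly in the torus side: the row sum of the organ's weight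
`Real.exp (−(κ * (b.src.tdist b′.src : ℝ)))` over the positively oriented bonds `b′` of a level is bounded by a constant of `κ` and the dimension alone.  LEAD's LOCATE
(20:29:54Z) found the site sum in `pdist` currency (✓`GlobalSlackKernelLeg.sum_exp_pdist_le`); the SAME sum in the organ's own `Site.tdist` currency is ALSO in the tree —
✓`Prop7TorusExpWeightSum.sum_exp_neg_mul_tdist_le : Σ_{x : Site P j} e^{−a·tdist(x, b)} ≤ (2(1 + 1∕a))^{d}` (px lineage, [Balaban1984PropagatorsII] (2.61)) — so no
`tdist ↔ pdist` bridge is needed.  This file adds the BOND form the organ sums over: ★`sum_pbond_exp_neg_mul_tdist_src_le : Σ_{b′ : PBond P j} e^{−a·tdist(b.src, b′.src)} ≤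
d·(2(1 + 1∕a))^{d}` (any `Params`, any level; `d` directions per source site, `Fintype.sum_prod_type'` through `PBond ≃ Site × Fin d` as in ✓`Prop7BlockBumpExtension.sum_pbond_eq`, `tdist` symmetric by `min_comm`; cf. the block-distance row sum ✓`Prop7OneFormAgmonLetters.sum_pbond_exp_neg_mul_tdist_le`, a different statement) and its d = 3
reading on the family's tori ★`sum_pbond_exp_neg_mul_tdist_src_le_three : … ≤ 3·(2(1 + 1∕κ))³` — the constant `C(κ)` of the memo, uniform in `j`, `K` and the side.  Importable by
`Lines/runpair_organ.lean` v18's `finiteChain_supR` re-proof (Lines may import Theorems).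

HONEST: an elementary counting lemma (geometric series on the discrete torus, already landed at the site level); nothing of Bałaban's analysis is asserted or proved; O1 (v17.2 or
v18), LIN∘, JEN∘, crux 20520 `FluctuationComparisonRegPrIntL`, `YM3TorusSU2` are NOT proved; rung R3 = SU(2) YM₃ on T³ — NOT d = 4, NOT infinite volume, NOT a mass gap, NOT
Clay; the Yang–Mills mass gap is NOT proved.
[cite: Balaban1984PropagatorsII, (2.61) p.234; Balaban1985Propagators, (1.19) p.393]
-/

set_option autoImplicit false

noncomputable section

namespace Summit.QuantumFields.YangMills.Theorems.OrganTangentBondRowSum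

open Literature.MathematicalPhysics.QuantumFieldTheory.Balaban1983to89
open Summit.QuantumFields.YangMills.Theorems.Prop7TorusExpWeightSum (sum_exp_neg_mul_tdist_le)

variable {P : Params} {j : ℕ}

/-- ★ **THE BOND ROW SUM OF THE ORGAN'S WEIGHT IS SIDE-UNIFORM**: for `a > 0` and every bond `b` of `T^{(j)}`,
`Σ_{b′ : PBond P j} e^{−a·tdist(b.src, b′.src)} ≤ d·(2(1 + 1∕a))^{d}` — `d` bonds per source site, then ✓`sum_exp_neg_mul_tdist_le`.
[cite: Balaban1984PropagatorsII, (2.61) p.234] -/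
theorem sum_pbond_exp_neg_mul_tdist_src_le (b : PBond P j) {a : ℝ} (ha : 0 < a) :
    ∑ b' : PBond P j, Real.exp (-(a * (b.src.tdist b'.src : ℝ))) ≤ (P.d : ℝ) * (2 * (1 + 1 / a)) ^ P.d := by
  classical
  -- a sum over bonds = the sum over source sites of the sum over the `d` directions (`PBond ≃ Site × Fin d`; cf. ✓`Prop7BlockBumpExtension.sum_pbond_eq`)
  have hsplit : ∑ b' : PBond P j, Real.exp (-(a * (b.src.tdist b'.src : ℝ))) =
      ∑ x : Site P j, ∑ _μ : Fin P.d, Real.exp (-(a * (b.src.tdist x : ℝ))) := by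
    rw [← Fintype.sum_prod_type' (f := fun (x : Site P j) (_μ : Fin P.d) => Real.exp (-(a * (b.src.tdist x : ℝ))))]
    exact (Fintype.sum_equiv (⟨fun p => ⟨p.1, p.2⟩, fun b' => (b'.src, b'.dir), fun _ => rfl, fun _ => rfl⟩ : Site P j × Fin P.d ≃ PBond P j)
      (fun p : Site P j × Fin P.d => Real.exp (-(a * (b.src.tdist p.1 : ℝ)))) _ (fun _ => rfl)).symm
  rw [hsplit]
  simp only [Finset.sum_const, Finset.card_univ, Fintype.card_fin, nsmul_eq_mul]
  rw [← Finset.mul_sum]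
  have hs : ∑ x : Site P j, Real.exp (-(a * (Site.tdist b.src x : ℝ))) ≤ (2 * (1 + 1 / a)) ^ P.d := by
    calc ∑ x : Site P j, Real.exp (-(a * (Site.tdist b.src x : ℝ)))
        = ∑ x : Site P j, Real.exp (-(a * (Site.tdist x b.src : ℝ))) :=
          Finset.sum_congr rfl fun x _ => by
            rw [show Site.tdist b.src x = Site.tdist x b.src from Finset.sum_congr rfl fun _ _ => min_comm _ _]
      _ ≤ (2 * (1 + 1 / a)) ^ P.d := sum_exp_neg_mul_tdist_le b.src ha
  exact mul_le_mul_of_nonneg_left hs (Nat.cast_nonneg _)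

/-- ★ **d = 3 READING ON THE FAMILY'S TORI** (the constant `C(κ)` of the O1 v18 memo, uniform in the height `j`, the run `K` and the side):
`Σ_{b′ : PBond (F.P K) j} e^{−κ·tdist(b.src, b′.src)} ≤ 3·(2(1 + 1∕κ))³`. [cite: Balaban1984PropagatorsII, (2.61) p.234; Balaban1985Propagators, (1.19) p.393] -/
theorem sum_pbond_exp_neg_mul_tdist_src_le_three (F : T3ContinuumYM3Torus.T3Family) (K j : ℕ) (b : PBond (F.P K) j) {κ : ℝ} (hκ : 0 < κ) :
    ∑ b' : PBond (F.P K) j, Real.exp (-(κ * (b.src.tdist b'.src : ℝ))) ≤ 3 * (2 * (1 + 1 / κ)) ^ 3 := by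
  have h := sum_pbond_exp_neg_mul_tdist_src_le b hκ
  have hd : (F.P K).d = 3 := rfl
  rw [hd] at h
  exact_mod_cast h

end Summit.QuantumFields.YangMills.Theorems.OrganTangentBondRowSum

end
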